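import Summits.NavierStokesRegularity.NavierStokesRegularity.Theorems.Target.Negative.NormalForms
import Summits.NavierStokesRegularity.NavierStokesRegularity.Theorems.TypeILiouvilleTypeIliouvilleNoTypeIIEternalSplitPressureFree
import HarnessLib

/-!
# Hard core `NoTypeII` (stmt-NavierStokesRegularity-0056 = `TypeILiouville.TypeIliouvilleNoTypeII`):
# NORMAL FORM `ν = 1`, `T = 1`, and the registered line `eternal_split` closed modulo the
# pressure-free eternal Liouville statement EEL′

Both symmetries of Navier–Stokes act on all clauses of the hard core «no Type-II blow-up»
(maximal smooth solution on `[0, T)`, Leray–Hopf from a rapidly decaying datum ⇒ Type-I rate at `T`):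
the viscosity normalisation `v(s, x) = ν⁻¹ u(s/ν, x)` maps `(ν, T) ↦ (1, νT)` (Tao 2013, fn. 3) and
Leray's similarity `w(s, y) = √T u(T s, √T y)` maps `(1, T) ↦ (1, 1)`; maximality is transported because
a classical continuation of the rescaled solution scales back to a continuation of `u`, and the Type-I
rate is scale invariant (constant `C ↦ √ν C`, resp. unchanged).  This is the Type-II-side twin of the
tree's `Target.Negative.target_iff_unit` (hard core 1217), whose rescaling steps are re-used here:

* `isTypeIBlowup_of_timeRescale`, `isTypeIBlowup_of_nsRescale` — the Type-I rate descends from the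
  rescaled field to `u`;
* `hasSmoothExtensionPast_of_timeRescale`, `hasSmoothExtensionPast_of_nsRescale` — continuations
  descend, hence maximality ascends (`isMaximalSmoothSolution_timeRescale_one`,
  `isMaximalSmoothSolution_nsRescale_one`);
* `typeIliouvilleNoTypeII_of_viscosity_one`, `noTypeII_one_of_unit`, **`typeIliouvilleNoTypeII_iff_unit`**:
  `NoTypeII ↔` its instance `ν = 1`, `T = 1` — §B candidates and their probes may assume unit scale;
* PAYOFF for the registered line `Cruxes/TypeIliouvilleNoTypeII/Lines/eternal_split.lean`:
  **`typeIliouvilleNoTypeII_of_energyTypeISlab_of_eternalLiouville'`** — the REGISTERED residual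
  `stub_energyTypeISlab` (Albritton–Barker's `𝐈 < ∞` on a final slab, verbatim signature) together with
  the PRESSURE-FREE eternal energy Liouville statement EEL′ (bounded eternal Oseen-mild smooth
  divergence-free `v`, `‖v‖ ≤ 2`, `A, C, E(v, ∇v)` bounded on all balls ⇒ `v 0 0 = 0`) give `NoTypeII`
  BY NAME: at unit scale the normalised field is `u` itself, so the `ν = 1` bridge
  `isTypeIBlowup_of_typeIBound_lt_top_of_eternalLiouville` of `…EternalSplitPressureFree.lean` applies and
  no viscosity covering of parabolic cylinders is needed.  Thus the line's provable stub 2 is DISCHARGED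
  in the kernel up to replacing EEL by EEL′ (stronger Liouville statement, weaker hypothesis on `v`:
  no pressure term), the pressure side being unreachable from tree parts today (ns-typeII-p2,
  STATUS 2026-08-26T16:08:52Z).

WHAT THIS IS NOT: not NS and not a proof of `NoTypeII`; `stub_energyTypeISlab` and EEL′ stay OPEN.
[folklore]
-/

noncomputable section

-- the summit and its single problem share the name (D-0017 nested layout)
set_option linter.dupNamespace false

open MeasureTheory Set Function Filter TopologicalSpace Metric
open scoped Topology NNReal ENNReal

namespace Summit.NavierStokesRegularity.NavierStokesRegularity.Theorems.TypeIliouvilleNoTypeII.EternalSplit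

open Literature.Analysis Literature.Analysis.FluidPDE
open Summit.NavierStokesRegularity.NavierStokesRegularity.Theses.TypeILiouville (TypeIliouvilleNoTypeII)
open Summit.NavierStokesRegularity.NavierStokesRegularity.Theorems.Target.Negative
  (tendsto_const_mul_nhdsLT hasRapidSpatialDecay_nsRescaleData)

variable {ν T : ℝ} {u : ℝ → EuclideanSpace ℝ (Fin 3) → EuclideanSpace ℝ (Fin 3)}
  {p : ℝ → EuclideanSpace ℝ (Fin 3) → ℝ}

/-! ### Viscosity normalisation `(ν, T) ↦ (1, νT)` -/

/-- Undoing the viscosity normalisation: `timeRescale ν ν (timeRescale ν⁻¹ ν⁻¹ u) = u`. [folklore] -/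
theorem timeRescale_timeRescale_inv (hν : ν ≠ 0)
    (u : ℝ → EuclideanSpace ℝ (Fin 3) → EuclideanSpace ℝ (Fin 3)) :
    timeRescale ν ν (timeRescale ν⁻¹ ν⁻¹ u) = u := by
  funext s x
  rw [timeRescale_apply, timeRescale_apply, smul_smul, mul_inv_cancel₀ hν, one_smul, ← mul_assoc,
    inv_mul_cancel₀ hν, one_mul]

/-- **The Type-I rate descends from the viscosity-normalised field**: if
`v(s, x) = ν⁻¹ u(s/ν, x)` has the Type-I rate at `νT` then `u` has it at `T`. [folklore] -/
theorem isTypeIBlowup_of_timeRescale (hν : 0 < ν)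
    (h : IsTypeIBlowup (timeRescale ν⁻¹ ν⁻¹ u) (ν * T)) : IsTypeIBlowup u T := by
  have hν0 : ν ≠ 0 := hν.ne'
  have hνi : 0 < ν⁻¹ := inv_pos.2 hν
  obtain ⟨C, hC⟩ := h
  refine ⟨ν * C / Real.sqrt ν, ?_⟩
  have ht : Tendsto (fun t : ℝ => ν * t) (𝓝[<] T) (𝓝[<] (ν * T)) := by
    have := tendsto_const_mul_nhdsLT (T := ν * T) hν
    rwa [← mul_assoc, inv_mul_cancel₀ hν0, one_mul] at this
  filter_upwards [ht.eventually hC, self_mem_nhdsWithin] with t hs htT x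
  have htT' : t < T := htT
  have hpos : 0 < T - t := sub_pos.2 htT'
  have hb := hs x
  rw [timeRescale_apply, norm_smul, Real.norm_eq_abs, abs_of_pos hνi, ← mul_assoc,
    inv_mul_cancel₀ hν0, one_mul] at hb
  have hsq : Real.sqrt (ν * T - ν * t) = Real.sqrt ν * Real.sqrt (T - t) := by
    rw [← mul_sub, Real.sqrt_mul hν.le]
  calc ‖u t x‖ ≤ ν * (C / Real.sqrt (ν * T - ν * t)) := (inv_mul_le_iff₀ hν).1 hb
    _ = ν * C / Real.sqrt ν / Real.sqrt (T - t) := by rw [hsq, mul_div_assoc', div_div]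

/-- **Continuations descend from the viscosity-normalised field**: a classical continuation of
`v = timeRescale ν⁻¹ ν⁻¹ u` (viscosity `1`) past `νT` scales back to a classical continuation of `u`
(viscosity `ν`) past `T` (Tao 2013, fn. 3; the step of the tree's `targetAt_of_viscosity_one`). [folklore] -/
theorem hasSmoothExtensionPast_of_timeRescale (hν : 0 < ν)
    (h : HasSmoothExtensionPast 1 0 (timeRescale ν⁻¹ ν⁻¹ u) (ν * T)) :
    HasSmoothExtensionPast ν 0 u T := by
  have hν0 : ν ≠ 0 := hν.ne'
  obtain ⟨T₁', hT₁', v', π', hcl', hagree'⟩ := h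
  have key := hcl'.stRescale hν one_pos (by rw [mul_one]) 0 0
  have hset : ((fun r => (0 : ℝ) + ν * r) ⁻¹' Ico 0 T₁') = Ico 0 (T₁' / ν) := by
    ext r
    simp only [mem_preimage, zero_add, mem_Ico]
    rw [lt_div_iff₀ hν, mul_comm r ν]
    constructor
    · rintro ⟨h0, h1⟩
      exact ⟨by nlinarith [h0, hν], h1⟩
    · rintro ⟨h0, h1⟩
      exact ⟨by positivity, h1⟩
  rw [hset, smul_stPull_zero, show ν * (1 : ℝ) / 1 = ν by simp] at key
  have hνT : ν * T < T₁' := hT₁'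
  refine ⟨T₁' / ν, by rw [gt_iff_lt, lt_div_iff₀ hν, mul_comm]; exact hνT, _, _, key, fun t ht => ?_⟩
  funext x
  have hνt : ν * t ∈ Ico 0 (ν * T) := ⟨mul_nonneg hν.le ht.1, mul_lt_mul_of_pos_left ht.2 hν⟩
  show ν • v' (0 + ν * t) (0 + (1 : ℝ) • x) = u t x
  rw [zero_add, zero_add, one_smul, hagree' (ν * t) hνt]
  show ν • (ν⁻¹ • u (ν⁻¹ * (ν * t)) x) = u t x
  rw [← mul_assoc, inv_mul_cancel₀ hν0, one_mul, smul_smul, mul_inv_cancel₀ hν0, one_smul]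

/-- **The frame ascends to the viscosity-normalised field**: a maximal smooth Leray–Hopf solution from
a rapidly decaying datum at `(ν, T)` becomes one at `(1, νT)` under `v(s, x) = ν⁻¹ u(s/ν, x)`,
`π(s, x) = ν⁻² p(s/ν, x)`. [cite: Tao2011, footnote 3] -/
theorem isMaximalSmoothSolution_timeRescale_one (hν : 0 < ν) (hT : 0 < T)
    (hmax : IsMaximalSmoothSolution ν 0 u p T) (hLH : IsLerayHopfOn T ν 0 (u 0) u)
    (hdec : HasRapidSpatialDecay (u 0)) :
    IsMaximalSmoothSolution 1 0 (timeRescale ν⁻¹ ν⁻¹ u) (timeRescale ν⁻¹ (ν⁻¹ ^ 2) p) (ν * T) ∧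
      IsLerayHopfOn (ν * T) 1 0 (timeRescale ν⁻¹ ν⁻¹ u 0) (timeRescale ν⁻¹ ν⁻¹ u) ∧
      HasRapidSpatialDecay (timeRescale ν⁻¹ ν⁻¹ u 0) := by
  have hν0 : ν ≠ 0 := hν.ne'
  have hνi : 0 < ν⁻¹ := inv_pos.2 hν
  have hmaps : MapsTo (fun s => ν⁻¹ * s) (Ico 0 (ν * T)) (Ico 0 T) := by
    intro s hs
    refine ⟨mul_nonneg hνi.le hs.1, ?_⟩
    calc ν⁻¹ * s < ν⁻¹ * (ν * T) := mul_lt_mul_of_pos_left hs.2 hνi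
      _ = T := by rw [← mul_assoc, inv_mul_cancel₀ hν0, one_mul]
  -- classical at viscosity 1 on `[0, νT)`
  have hclv : IsClassicalNSSolutionOn (Ico 0 (ν * T)) 1 0 (timeRescale ν⁻¹ ν⁻¹ u)
      (timeRescale ν⁻¹ (ν⁻¹ ^ 2) p) := by
    have h := hmax.1.viscosityRescale_set hν0 hmaps (uniqueDiffOn_Ico 0 (ν * T))
    rwa [timeRescale_zero_force] at h
  -- Leray–Hopf
  have hv0 : ν⁻¹ • u 0 = timeRescale ν⁻¹ ν⁻¹ u 0 := by
    funext x
    rw [Pi.smul_apply, timeRescale_apply, mul_zero]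
  have hLHv : IsLerayHopfOn (ν * T) 1 0 (timeRescale ν⁻¹ ν⁻¹ u 0) (timeRescale ν⁻¹ ν⁻¹ u) := by
    have h := hLH.viscosityRescale hνi
    have e1 : T / ν⁻¹ = ν * T := by rw [div_inv_eq_mul, mul_comm]
    rwa [e1, inv_mul_cancel₀ hν0, timeRescale_zero_force, hv0] at h
  -- decay of the datum
  have hdecv : HasRapidSpatialDecay (timeRescale ν⁻¹ ν⁻¹ u 0) := by
    rw [← hv0]
    exact SereginSverak2002_pressureOneSidedBound.hasRapidSpatialDecay_const_smul
      (hmax.1.contDiff_velocity ⟨le_rfl, hT⟩) hdec ν⁻¹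
  exact ⟨⟨hclv, fun hext => hmax.2 (hasSmoothExtensionPast_of_timeRescale hν hext)⟩, hLHv, hdecv⟩

/-- **Viscosity normalisation of the hard core**: `NoTypeII` at viscosity `1` (all lifespans) gives
`NoTypeII`. [cite: Tao2011, footnote 3] -/
theorem typeIliouvilleNoTypeII_of_viscosity_one
    (h1 : ∀ T : ℝ, 0 < T → ∀ (u : ℝ → EuclideanSpace ℝ (Fin 3) → EuclideanSpace ℝ (Fin 3))
      (p : ℝ → EuclideanSpace ℝ (Fin 3) → ℝ),
      IsMaximalSmoothSolution 1 0 u p T → IsLerayHopfOn T 1 0 (u 0) u → HasRapidSpatialDecay (u 0) →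
      IsTypeIBlowup u T) :
    TypeIliouvilleNoTypeII := by
  intro ν T hν hT u p hmax hLH hdec
  obtain ⟨hmaxv, hLHv, hdecv⟩ := isMaximalSmoothSolution_timeRescale_one hν hT hmax hLH hdec
  exact isTypeIBlowup_of_timeRescale hν (h1 (ν * T) (mul_pos hν hT) _ _ hmaxv hLHv hdecv)

/-! ### Leray's similarity `(1, T) ↦ (1, 1)` -/

/-- **The Type-I rate descends from Leray's similarity**: if `w(s, y) = √T u(T s, √T y)` has the Type-I
rate at `1` then `u` has it at `T`, with the same constant. [cite: Leray1934, §20] -/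
theorem isTypeIBlowup_of_nsRescale (hT : 0 < T) (h : IsTypeIBlowup (nsRescale (Real.sqrt T) u) 1) :
    IsTypeIBlowup u T := by
  set c : ℝ := Real.sqrt T with hc
  have hcpos : 0 < c := Real.sqrt_pos.2 hT
  have hc2 : c ^ 2 = T := Real.sq_sqrt hT.le
  obtain ⟨C, hC⟩ := h
  refine ⟨C, ?_⟩
  have ht : Tendsto (fun t : ℝ => T⁻¹ * t) (𝓝[<] T) (𝓝[<] 1) := by
    have := tendsto_const_mul_nhdsLT (T := 1) (inv_pos.2 hT)
    rwa [inv_inv, mul_one] at this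
  filter_upwards [ht.eventually hC, self_mem_nhdsWithin] with t hs htT x
  have htT' : t < T := htT
  have hpos : 0 < T - t := sub_pos.2 htT'
  have hb := hs (c⁻¹ • x)
  rw [nsRescale_apply, smul_smul, mul_inv_cancel₀ hcpos.ne', one_smul, hc2, ← mul_assoc,
    mul_inv_cancel₀ hT.ne', one_mul, norm_smul, Real.norm_eq_abs, abs_of_pos hcpos] at hb
  -- `hb : c * ‖u t x‖ ≤ C / √(1 - T⁻¹ t)`, and `√(1 - T⁻¹ t) = √(T - t)/c`
  have hsq : Real.sqrt (1 - T⁻¹ * t) = Real.sqrt (T - t) / c := by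
    rw [show 1 - T⁻¹ * t = (T - t) / T by field_simp, Real.sqrt_div' _ hT.le, ← hc]
  rw [hsq, div_div_eq_mul_div] at hb
  have hsr : 0 < Real.sqrt (T - t) := Real.sqrt_pos.2 hpos
  rw [le_div_iff₀ hsr] at hb ⊢
  nlinarith [hb, hcpos]

/-- **Continuations descend from Leray's similarity**: a classical continuation of
`w = nsRescale √T u` (viscosity `1`) past `1` scales back to a continuation of `u` past `T` (the step of
the tree's `targetAt_one_of_unit`). [cite: Leray1934, §20] -/
theorem hasSmoothExtensionPast_of_nsRescale (hT : 0 < T)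
    (h : HasSmoothExtensionPast 1 0 (nsRescale (Real.sqrt T) u) 1) :
    HasSmoothExtensionPast 1 0 u T := by
  set c : ℝ := Real.sqrt T with hc
  have hcpos : 0 < c := Real.sqrt_pos.2 hT
  have hc2 : c ^ 2 = T := Real.sq_sqrt hT.le
  obtain ⟨T₂', hT₂', w', ϖ', hcl', hagree'⟩ := h
  have hci : 0 < c⁻¹ := inv_pos.2 hcpos
  have key := IsClassicalNSSolutionOn.nsRescale_holds hcl' hci
  have hset' : ((fun t => c⁻¹ ^ 2 * t) ⁻¹' Ico 0 T₂') = Ico 0 (T * T₂') := by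
    ext t
    simp only [mem_preimage, mem_Ico, inv_pow, hc2]
    rw [← div_eq_inv_mul, le_div_iff₀ hT, div_lt_iff₀ hT, zero_mul, mul_comm T₂' T]
  rw [hset', nsRescaleForce_zero] at key
  have h1 : (1 : ℝ) < T₂' := hT₂'
  refine ⟨T * T₂', by nlinarith, _, _, key, fun t ht => ?_⟩
  funext x
  have hts : c⁻¹ ^ 2 * t ∈ Ico 0 1 := by
    rw [inv_pow, hc2, ← div_eq_inv_mul]
    exact ⟨div_nonneg ht.1 hT.le, (div_lt_one hT).2 ht.2⟩
  show c⁻¹ • w' (c⁻¹ ^ 2 * t) (c⁻¹ • x) = u t x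
  rw [hagree' _ hts]
  show c⁻¹ • (c • u (c ^ 2 * (c⁻¹ ^ 2 * t)) (c • c⁻¹ • x)) = u t x
  rw [smul_smul, smul_smul, inv_mul_cancel₀ hcpos.ne', one_smul, mul_inv_cancel₀ hcpos.ne', one_smul,
    ← mul_assoc, ← mul_pow, mul_inv_cancel₀ hcpos.ne', one_pow, one_mul]

/-- **The frame ascends along Leray's similarity**: a maximal smooth Leray–Hopf solution from a
rapidly decaying datum at `(1, T)` becomes one at `(1, 1)` under `w = nsRescale √T u`,
`ϖ = nsRescalePressure √T p`. [cite: Leray1934, §20] -/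
theorem isMaximalSmoothSolution_nsRescale_one (hT : 0 < T)
    (hmax : IsMaximalSmoothSolution 1 0 u p T) (hLH : IsLerayHopfOn T 1 0 (u 0) u)
    (hdec : HasRapidSpatialDecay (u 0)) :
    IsMaximalSmoothSolution 1 0 (nsRescale (Real.sqrt T) u) (nsRescalePressure (Real.sqrt T) p) 1 ∧
      IsLerayHopfOn 1 1 0 (nsRescale (Real.sqrt T) u 0) (nsRescale (Real.sqrt T) u) ∧
      HasRapidSpatialDecay (nsRescale (Real.sqrt T) u 0) := by
  set c : ℝ := Real.sqrt T with hc
  have hcpos : 0 < c := Real.sqrt_pos.2 hT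
  have hc2 : c ^ 2 = T := Real.sq_sqrt hT.le
  -- classical on `[0, 1)`
  have hset : ((fun t => c ^ 2 * t) ⁻¹' Ico 0 T) = Ico 0 1 := by
    ext t
    simp only [mem_preimage, mem_Ico, hc2]
    constructor
    · rintro ⟨h0, h1⟩
      exact ⟨nonneg_of_mul_nonneg_right h0 hT, by nlinarith⟩
    · rintro ⟨h0, h1⟩
      exact ⟨by positivity, by nlinarith⟩
  have hclw : IsClassicalNSSolutionOn (Ico 0 1) 1 0 (nsRescale c u) (nsRescalePressure c p) := by
    have h := IsClassicalNSSolutionOn.nsRescale_holds hmax.1 hcpos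
    rwa [hset, nsRescaleForce_zero] at h
  -- Leray–Hopf on `[0, 1)`
  have hw0 : nsRescaleData c (u 0) = nsRescale c u 0 := by
    funext x
    rw [nsRescale_apply, nsRescaleData_apply, mul_zero]
  have hLHw : IsLerayHopfOn 1 1 0 (nsRescale c u 0) (nsRescale c u) := by
    have h := IsLerayHopfOn.nsRescale_holds hLH hcpos
    rwa [hc2, div_self hT.ne', nsRescaleForce_zero, hw0] at h
  -- decay
  have hdecw : HasRapidSpatialDecay (nsRescale c u 0) := by
    rw [← hw0]
    exact hasRapidSpatialDecay_nsRescaleData (hmax.1.contDiff_velocity ⟨le_rfl, hT⟩) hdec hcpos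
  exact ⟨⟨hclw, fun hext => hmax.2 (hasSmoothExtensionPast_of_nsRescale hT hext)⟩, hLHw, hdecw⟩

/-- **Time normalisation of the hard core at unit viscosity**: `NoTypeII` at `ν = 1`, `T = 1` gives
`NoTypeII` at `ν = 1` for every lifespan. [cite: Leray1934, §20] -/
theorem noTypeII_one_of_unit
    (h11 : ∀ (u : ℝ → EuclideanSpace ℝ (Fin 3) → EuclideanSpace ℝ (Fin 3))
      (p : ℝ → EuclideanSpace ℝ (Fin 3) → ℝ),
      IsMaximalSmoothSolution 1 0 u p 1 → IsLerayHopfOn 1 1 0 (u 0) u → HasRapidSpatialDecay (u 0) →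
      IsTypeIBlowup u 1) {T : ℝ} (hT : 0 < T)
    (u : ℝ → EuclideanSpace ℝ (Fin 3) → EuclideanSpace ℝ (Fin 3))
    (p : ℝ → EuclideanSpace ℝ (Fin 3) → ℝ)
    (hmax : IsMaximalSmoothSolution 1 0 u p T) (hLH : IsLerayHopfOn T 1 0 (u 0) u)
    (hdec : HasRapidSpatialDecay (u 0)) : IsTypeIBlowup u T := by
  obtain ⟨hmaxw, hLHw, hdecw⟩ := isMaximalSmoothSolution_nsRescale_one hT hmax hLH hdec
  exact isTypeIBlowup_of_nsRescale hT (h11 _ _ hmaxw hLHw hdecw)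

/-- **NORMAL FORM of the hard core «no Type-II blow-up».** `NoTypeII` is equivalent to its instance
`ν = 1`, `T = 1`: every maximal smooth unit-viscosity solution on `ℝ³ × [0, 1)`, Leray–Hopf from a
rapidly decaying datum, blows up at the Type-I rate at `1`. [folklore] -/
theorem typeIliouvilleNoTypeII_iff_unit :
    TypeIliouvilleNoTypeII ↔
      ∀ (u : ℝ → EuclideanSpace ℝ (Fin 3) → EuclideanSpace ℝ (Fin 3))
        (p : ℝ → EuclideanSpace ℝ (Fin 3) → ℝ),
        IsMaximalSmoothSolution 1 0 u p 1 → IsLerayHopfOn 1 1 0 (u 0) u →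
        HasRapidSpatialDecay (u 0) → IsTypeIBlowup u 1 :=
  ⟨fun h u p hmax hLH hdec => h 1 1 one_pos one_pos u p hmax hLH hdec,
    fun h11 => typeIliouvilleNoTypeII_of_viscosity_one fun _ hT u p hmax hLH hdec =>
      noTypeII_one_of_unit h11 hT u p hmax hLH hdec⟩

/-! ### The registered line `eternal_split` closed modulo EEL′ -/

/-- **`NoTypeII` from the unit-scale energy-Type-I slab bound and EEL′.** If every maximal smooth
unit-viscosity solution on `[0, 1)`, Leray–Hopf from a rapidly decaying datum, has Albritton–Barker's
full Type-I quantity finite on some final slab `(1 - r², 1) × ℝ³`, and the pressure-free eternal energy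
Liouville statement EEL′ holds, then `NoTypeII`. [folklore] -/
theorem typeIliouvilleNoTypeII_of_energyTypeISlab_unit_of_eternalLiouville
    (hS : ∀ (u : ℝ → EuclideanSpace ℝ (Fin 3) → EuclideanSpace ℝ (Fin 3))
      (p : ℝ → EuclideanSpace ℝ (Fin 3) → ℝ),
      IsMaximalSmoothSolution 1 0 u p 1 → IsLerayHopfOn 1 1 0 (u 0) u → HasRapidSpatialDecay (u 0) →
      ∃ r : ℝ, 0 < r ∧
        typeIBound (Ioo (1 - r ^ 2) 1 ×ˢ univ) u p (fun t y => fderiv ℝ (u t) y) < ⊤)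
    (hEEL : ∀ v : ℝ → EuclideanSpace ℝ (Fin 3) → EuclideanSpace ℝ (Fin 3),
      ContDiff ℝ (⊤ : ℕ∞) (uncurry v) → (∀ t, VectorCalculus.IsDivFree (v t)) →
      (∀ s t : ℝ, s < t → ∀ x, v t x = heatFlow (v s) (t - s) x - oseenDuhamel 1 s v v t x) →
      (∀ t x, ‖v t x‖ ≤ 2) →
      (∃ I : ℝ≥0∞, I ≠ ⊤ ∧ ∀ r : ℝ, 0 < r → ∀ z : ℝ × EuclideanSpace ℝ (Fin 3),
        cknAEss r z v ≤ I ∧ cknC r z v ≤ I ∧ cknE r z (fun s y => fderiv ℝ (v s) y) ≤ I) →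
      v 0 0 = 0) :
    TypeIliouvilleNoTypeII := by
  refine typeIliouvilleNoTypeII_iff_unit.2 fun u p hmax hLH hdec => ?_
  obtain ⟨r, hr, hI⟩ := hS u p hmax hLH hdec
  exact isTypeIBlowup_of_typeIBound_lt_top_of_eternalLiouville one_pos hmax hLH hdec hr hI hEEL

/-- **The REGISTERED residual `stub_energyTypeISlab` and EEL′ give `NoTypeII`, by name.**  The first
hypothesis is VERBATIM the signature of `stub_energyTypeISlab` of
`Cruxes/TypeIliouvilleNoTypeII/Lines/eternal_split.lean` (all viscosities and lifespans; only its unit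
instance is used); the second is EEL′.  So the line's provable stub `stub_eternalProfileOfTypeII` is
discharged in the kernel up to trading EEL for the pressure-free EEL′. [folklore] -/
theorem typeIliouvilleNoTypeII_of_energyTypeISlab_of_eternalLiouville'
    (hS : ∀ (ν T : ℝ), 0 < ν → 0 < T →
      ∀ (u : ℝ → EuclideanSpace ℝ (Fin 3) → EuclideanSpace ℝ (Fin 3))
        (p : ℝ → EuclideanSpace ℝ (Fin 3) → ℝ),
      IsMaximalSmoothSolution ν 0 u p T → IsLerayHopfOn T ν 0 (u 0) u → HasRapidSpatialDecay (u 0) →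
      ∃ r : ℝ, 0 < r ∧ r ^ 2 ≤ T ∧
        typeIBound (Ioo (T - r ^ 2) T ×ˢ (univ : Set (EuclideanSpace ℝ (Fin 3)))) u p
          (fun t y => fderiv ℝ (u t) y) < ⊤)
    (hEEL : ∀ v : ℝ → EuclideanSpace ℝ (Fin 3) → EuclideanSpace ℝ (Fin 3),
      ContDiff ℝ (⊤ : ℕ∞) (uncurry v) → (∀ t, VectorCalculus.IsDivFree (v t)) →
      (∀ s t : ℝ, s < t → ∀ x, v t x = heatFlow (v s) (t - s) x - oseenDuhamel 1 s v v t x) →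
      (∀ t x, ‖v t x‖ ≤ 2) →
      (∃ I : ℝ≥0∞, I ≠ ⊤ ∧ ∀ r : ℝ, 0 < r → ∀ z : ℝ × EuclideanSpace ℝ (Fin 3),
        cknAEss r z v ≤ I ∧ cknC r z v ≤ I ∧ cknE r z (fun s y => fderiv ℝ (v s) y) ≤ I) →
      v 0 0 = 0) :
    TypeIliouvilleNoTypeII :=
  typeIliouvilleNoTypeII_of_energyTypeISlab_unit_of_eternalLiouville
    (fun u p hmax hLH hdec => by
      obtain ⟨r, hr, -, hI⟩ := hS 1 1 one_pos one_pos u p hmax hLH hdec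
      exact ⟨r, hr, hI⟩)
    hEEL

end Summit.NavierStokesRegularity.NavierStokesRegularity.Theorems.TypeIliouvilleNoTypeII.EternalSplit

end
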